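import Summits.BirchSwinnertonDyer.BirchSwinnertonDyer.Theses.KatoDescentPotSupersingular
import Summits.BirchSwinnertonDyer.Rank1Residual.X11b.KolyvaginBottomPoint
import Summits.BirchSwinnertonDyer.Rank1Residual.X11b.Three.KolyvaginLine
import Summits.BirchSwinnertonDyer.Rank1Residual.X11b.BDPRouteRankOneBookkeeping
import Literature.NumberTheory.EllipticCurves.HeegnerPointsOfConductorOneData
import Literature.NumberTheory.EllipticCurves.HeegnerPointsOfConductorOneRationalityProofs
import Literature.NumberTheory.EllipticCurves.HeegnerPointsOfConductorOneGaloisConjProofs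
import Literature.NumberTheory.EllipticCurves.HeegnerPointsKolyvaginPrimaryGeneratorProofs
import Literature.NumberTheory.EllipticCurves.BSDSelmerCMPConverseHeegnerFieldProofs
import Literature.NumberTheory.EllipticCurves.CuspFormLFunctionLevelConductorProofs
import HarnessLib

/-!
# Route `KatoDescentPotSupersingular` (rung K9, sub-rung B5 O6 wild 3, cell `bsd-potss`): the `q = p` crux
# `WildJetchevBoundAtP` (item 19941) REDUCED IN THE KERNEL to the shared structure stub S1 of crux 20165
# (`stub_structureIrred`, = MN19 Thm. 0.7/§0.11 by name) + ONE at-`p` divisibility statement at conductor level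
# (seat `bsd-potss-k9-c4` g8; `--supports 19941`, helper; nothing booked, no item closed, BSD is not proved by any of this)

WHAT IS PROVED. The `q = p` twin of `bsd-potss-k8t-c4` g8's bridge
`JetchevIrreducibleReadingOfStubs.cor15_irreducibleReading_of_structureIrred_of_divisibilityIrred_of_kolyvagin_of_newforms`
(p502280): Jetchev's printed deduction *"Cor. 1.5 ⟸ Thm. 1.4 and Kolyvagin's formula"* (Compos. Math. 144 (2008)
p. 812) run in the kernel with the Tamagawa carrier the ADDITIVE prime `p` itself. The body of the K9 crux
`WildJetchevBoundAtP` — `ord_p #Ш(W/K)[p^∞] + 2·ord_p c_p(W) ≤ 2·ord_p [W(K) : ℤP]` at any stated level `N`, Heegner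
point `P` of infinite order, index currency — follows, AT EVERY HEEGNER FIELD WITH `d_K ≠ −4`, from

* `hS` — (S1) Kolyvagin's structure theorem, UPPER half, under IRREDUCIBILITY of `E[p]`, NO reduction binder at `p`,
  McCallum currency (`ord_p #Ш(E/K)[p^∞] + 2t ≤ 2M₀` when every derived Heegner point is `p^s`-divisible for all
  `s ≤ t`) — VERBATIM the registered stub `stub_structureIrred` of the shared crux `JetchevIrreducibleReadingByName`
  (item 20165, skeleton v3) = the Literature fact
  `MatarNekovar2019.thm07_padicValNat_card_sha_primary_add_le_of_globalDivisibility_of_irreducible` (p503175) by name;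
* `hDp` — (S2p) GLOBAL DIVISIBILITY AT THE ADDITIVE PRIME: on a frame of level `N_E` whose conductor-`1` derived point
  has infinite order, every derived Heegner point `P_n` (square-free `n`, Kolyvagin primes of index `≥ s`) is
  `p^s`-divisible in `E(K[n])` for every `s ≤ ord_p c_p(E)` — the `q = p` share of Jetchev's Conjecture 1.3
  (`m_∞ = ord_p ∏ c_q`), with ALL the crux's row binders kept (`r_an = 0`, additive potentially good `p`, non-CM,
  `E[p]` irreducible, `p`-adic tower not onto, a lattice-optimal datum with `p ∤ c`). NOT in print (Jetchev's
  Hypothesis (∗) has `p ∤ N`; his Lemma 4.3 is `v ∤ p`); this is the research content of 19941, displayed, nothing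
  asserted. Content only at `p = 3`, Kodaira IV / IV*, `c₃ = 3` (depth 1), since `c_p ∈ {1,2,3,4}` at additive `p`;
* Kolyvagin 1990 (`kolyvagin N W K`) and modularity (`exists_isNewformOf` ⇒ Carayol `N = N_E`) — conjuncts 2 and 4 of
  the route's held `PublishedInputsHeegner` (item 19914);

through tree THEOREMS only (Darmon 3.6 `phi_heegnerTau_mem_singularModuliField_holds`, Shimura reciprocity
`heegnerPointOfConductor_one_galoisConj_holds`, Mordell–Weil, McCallum Lemma 5.1 via
`Three.Koly.padicValNat_index_zmultiples_eq_of_divisibility`, no `p`-torsion in `E(K)` from irreducibility).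

WHY `d_K ≠ −4`. S1 is printed for `D_K ≠ −3, −4` (MN19 Thm. 0.7); the crux 19941 displays only `d_K ≠ −3`. Its ONE
consumer in the cone of `closes` — `WildUpperOptimalSharpRoadJ08.missingUpperBoundAt_rankZero_of_optimalDatum_of_jetchev08_of_boundAtP`
(l.146–147: the Bump–Friedberg–Hoffstein field has `d_K < −4`) — never uses the `d_K = −4` instances. So §3 states the
crux BY NAME from S1, S2p, `PublishedInputsHeegner` and the DISPLAYED `d_K = −4` supplement `h4` (the crux body at
the Gaussian field — an idle instance for the route; the planner may drop it by adding the binder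
`NumberField.discr K ≠ -4` to 19941, after which §2 is the by-name reduction). The sequel `…WildJetchevBoundAtPSkeletonRekey` re-keys the registered
skeleton (`Cruxes/WildJetchevBoundAtP/Lines/birth.lean`) on S1 / S2p. CONDITIONAL throughout; the crux, S1, S2p and
BSD stay exactly as open as before.

References: [Jetchev2008] Conj. 1.3, Thm. 1.4, Cor. 1.5 (p. 812), Lemma 4.3, Rem. 6.2; [MatarNekovar2019] Thm. 0.7,
§0.11 (pp. 456–457); [McCallumLMS1991] §5 Lemma 5.1 (p. 303), Cor. 5.6 (p. 310); [GrossLMS1991] §4 (4.1), Prop.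
6.2 (1); [Darmon2004] Thm. 3.6–3.7; [Kolyvagin1990] Thm. A.
-/

set_option autoImplicit false
-- the Theorems directory repeats the summit name (sibling precedent `KatoDescentPotSupersingularAssembly.lean`)
set_option linter.dupNamespace false

noncomputable section

open scoped Classical

namespace Summit.BirchSwinnertonDyer.BirchSwinnertonDyer.Theorems.WildJetchevBoundAtPOfStubs

open WeierstrassCurve Literature.NumberTheory.EllipticCurves
  Literature.NumberTheory.EllipticCurves.ModularForms
  Literature.NumberTheory.EllipticCurves.Rank1Residual
  Summit.BirchSwinnertonDyer.Rank1Residual Summit.BirchSwinnertonDyer.Rank1Residual.X11b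

/-! ### §1 Frame currency over `K` at the carrier `q = p`: S1 ∘ S2p -/

/-- **The `q = p` bound over `K`, frame currency.** Under the displayed statements `hS` (S1 = the registered stub
`stub_structureIrred` of crux 20165 verbatim) and `hDp` (S2p: divisibility to depth `ord_p c_p` at conductor level,
all row binders of the crux kept): for `W/ℚ` globally minimal non-CM of analytic rank `0`, `K` imaginary quadratic
Heegner for `N = W.conductorNorm ℤ` with `d_K ∉ {−3, −4}`, `p ≠ 2` additive potentially good with `E[p]` irreducible
and the `p`-adic tower not onto, a lattice-optimal datum of level `N_E` with `p ∤ c`, a frame `(Dt, β, ι)` with a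
conductor-`1` datum `d₁` whose derived point is `P ∈ E(K)` in `E(K̄)`, `P` of infinite order with `p^{M₀} ∥ P`:
`ord_p #Ш(E/K)[p^∞] + 2·ord_p c_p ≤ 2·M₀`. CONDITIONAL on `hS` and `hDp`; nothing asserted.
[cite: Jetchev2008, Conj. 1.3 and Cor. 1.5 (p. 812)] [cite: McCallumLMS1991, §5 Cor. 5.6 (p. 310)]
[cite: MatarNekovar2019, Thm. 0.7 and §0.11 (pp. 456–457)] -/
theorem padicValNat_card_sha_primary_add_le_of_structureIrred_of_divisibilityAtP
    (hS : ∀ (W : WeierstrassCurve ℚ) [W.IsElliptic] [W.IsGloballyMinimal] [NeZero (W.conductorNorm ℤ)],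
      ¬ W.HasCM →
      ∀ (K : Type) [Field K] [NumberField K], IsImaginaryQuadratic K →
      NumberField.discr K ≠ -3 → NumberField.discr K ≠ -4 →
      SatisfiesHeegnerHypothesis (W.conductorNorm ℤ) K →
      ∀ (p : ℕ) [Fact p.Prime], p ≠ 2 → W.HasIrreducibleModPGaloisRep p →
      ∀ (Dt : ModularParametrizationData W (W.conductorNorm ℤ)) (β : ℤ) (ι : K →+* ℂ)
        (d₁ : KolyvaginHeegnerData Dt β ι 1) (P : (W.baseChange K).toAffine.Point),
        d₁.toGeomPoints d₁.derivedPoint = toGeomPoints (W.baseChange K) P →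
        ¬ IsOfFinAddOrder P →
      ∀ (M₀ : ℕ),
        (∃ Q : (W.baseChange K).toAffine.Point, ((p ^ M₀ : ℕ) : ℤ) • Q = P) →
        (¬ ∃ Q : (W.baseChange K).toAffine.Point, ((p ^ (M₀ + 1) : ℕ) : ℤ) • Q = P) →
      ∀ (t : ℕ),
        (∀ (s : ℕ), s ≤ t → ∀ (n : ℕ) (d : KolyvaginHeegnerData Dt β ι n), Squarefree n →
          (∀ ℓ ∈ n.primeFactors, Zhang2014.IsKolyvaginPrime (W.conductorNorm ℤ) W K p ℓ ∧
            s ≤ Zhang2014.kolyvaginIndex W p ℓ) →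
          ∃ Q : (W.baseChange (ringClassField K ι n)).toAffine.Point,
            ((p ^ s : ℕ) : ℤ) • Q = d.derivedPoint) →
      padicValNat p (Nat.card (AddCommGroup.primaryComponent (W.baseChange K).sha p)) + 2 * t ≤ 2 * M₀)
    (hDp : ∀ (W : WeierstrassCurve ℚ) [W.IsElliptic] [W.IsGloballyMinimal] [NeZero (W.conductorNorm ℤ)],
      ¬ W.HasCM →
      ∀ (K : Type) [Field K] [NumberField K], IsImaginaryQuadratic K →
      NumberField.discr K ≠ -3 → NumberField.discr K ≠ -4 →
      SatisfiesHeegnerHypothesis (W.conductorNorm ℤ) K →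
      ∀ (p : ℕ) [Fact p.Prime], p ≠ 2 → W.analyticRank = 0 → Addv W p → 0 ≤ padicValRat p W.j →
      W.HasIrreducibleModPGaloisRep p → ¬ (∀ n : ℕ, W.HasSurjectiveModNGaloisRep (p ^ n : ℕ)) →
      (∃ Dt : ModularParametrizationData W (W.conductorNorm ℤ),
        (∀ z ∈ Dt.L.lattice, ∃ w ∈ periodLattice Dt.f, z = (Dt.c : ℂ) * w) ∧ ¬ (p : ℤ) ∣ Dt.c) →
      ∀ (Dt : ModularParametrizationData W (W.conductorNorm ℤ)) (β : ℤ) (ι : K →+* ℂ)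
        (d₁ : KolyvaginHeegnerData Dt β ι 1), ¬ IsOfFinAddOrder d₁.derivedPoint →
      ∀ (s : ℕ), s ≤ padicValNat p ((W.baseChange ℚ_[p]).localTamagawaNumber ℤ_[p]) →
      ∀ (n : ℕ) (d : KolyvaginHeegnerData Dt β ι n), Squarefree n →
        (∀ ℓ ∈ n.primeFactors, Zhang2014.IsKolyvaginPrime (W.conductorNorm ℤ) W K p ℓ ∧
          s ≤ Zhang2014.kolyvaginIndex W p ℓ) →
        ∃ Q : (W.baseChange (ringClassField K ι n)).toAffine.Point,
          ((p ^ s : ℕ) : ℤ) • Q = d.derivedPoint)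
    (W : WeierstrassCurve ℚ) [W.IsElliptic] [W.IsGloballyMinimal] [NeZero (W.conductorNorm ℤ)]
    (hcm : ¬ W.HasCM) (K : Type) [Field K] [NumberField K] (hK : IsImaginaryQuadratic K)
    (hD3 : NumberField.discr K ≠ -3) (hD4 : NumberField.discr K ≠ -4)
    (hH : SatisfiesHeegnerHypothesis (W.conductorNorm ℤ) K)
    (p : ℕ) [Fact p.Prime] (hp2 : p ≠ 2) (hr : W.analyticRank = 0) (hadd : Addv W p)
    (hj : 0 ≤ padicValRat p W.j) (hirr : W.HasIrreducibleModPGaloisRep p)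
    (hns : ¬ (∀ n : ℕ, W.HasSurjectiveModNGaloisRep (p ^ n : ℕ)))
    (hopt : ∃ Dt : ModularParametrizationData W (W.conductorNorm ℤ),
      (∀ z ∈ Dt.L.lattice, ∃ w ∈ periodLattice Dt.f, z = (Dt.c : ℂ) * w) ∧ ¬ (p : ℤ) ∣ Dt.c)
    (Dt : ModularParametrizationData W (W.conductorNorm ℤ)) (β : ℤ) (ι : K →+* ℂ)
    (d₁ : KolyvaginHeegnerData Dt β ι 1) (P : (W.baseChange K).toAffine.Point)
    (hPd : d₁.toGeomPoints d₁.derivedPoint = toGeomPoints (W.baseChange K) P)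
    (hnt : ¬ IsOfFinAddOrder P) (M₀ : ℕ)
    (hdiv : ∃ Q : (W.baseChange K).toAffine.Point, ((p ^ M₀ : ℕ) : ℤ) • Q = P)
    (hndiv : ¬ ∃ Q : (W.baseChange K).toAffine.Point, ((p ^ (M₀ + 1) : ℕ) : ℤ) • Q = P) :
    padicValNat p (Nat.card (AddCommGroup.primaryComponent (W.baseChange K).sha p)) +
        2 * padicValNat p ((W.baseChange ℚ_[p]).localTamagawaNumber ℤ_[p]) ≤ 2 * M₀ := by
  -- `P_1` has infinite order since `P` has (same image in `E(K̄)`, injective maps)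
  have hy₁ : ¬ IsOfFinAddOrder d₁.derivedPoint := by
    intro hfin
    apply hnt
    have h1 : IsOfFinAddOrder (d₁.toGeomPoints d₁.derivedPoint) :=
      d₁.toGeomPoints.isOfFinAddOrder hfin
    rw [hPd] at h1
    exact (toGeomPoints_injective (W.baseChange K)).isOfFinAddOrder_iff.mp h1
  -- S1 at `t := ord_p c_p`, the global divisibility to that depth supplied by S2p
  exact hS W hcm K hK hD3 hD4 hH p hp2 hirr Dt β ι d₁ P hPd hnt M₀ hdiv hndiv
    (padicValNat p ((W.baseChange ℚ_[p]).localTamagawaNumber ℤ_[p]))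
    (fun s hs n d hn hℓ ↦ hDp W hcm K hK hD3 hD4 hH p hp2 hr hadd hj hirr hns hopt Dt β ι d₁ hy₁ s hs n d
      hn hℓ)

/-! ### §2 The `q = p` reading at any stated level `N` (index currency), at every Heegner field with `d_K ≠ −4` -/

/-- **The body of `WildJetchevBoundAtP` at `d_K ≠ −4` from S1 + S2p + Kolyvagin + modularity.** Steps (as the
k8t-c4 bridge p502280 §2): the parametrisation datum inside `IsHeegnerPoint N W K P` carries a newform of level `N`
for `W`, so `N = W.conductorNorm ℤ` by Carayol from modularity; rank one of `E(K)` (Kolyvagin, `hKo`); a frame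
`(Dt, H, ι)` of `P` with a conductor-`1` datum `d₁` (Darmon 3.6, PROVED) whose bottom point is `P` (Shimura, PROVED);
`p^{M₀} ∥ P` (Mordell–Weil); §1; `ord_p [E(K):ℤP] = M₀` (McCallum Lemma 5.1: rank one, no `p`-torsion in `E(K)`
for `E[p]` irreducible over the imaginary quadratic `K`). The binder `p ∣ N` is not used (it follows from `Addv`).
CONDITIONAL on `hS`, `hDp`, `hKo`, `hnf`; nothing asserted.
[cite: Jetchev2008, Cor. 1.5 (p. 812)] [cite: McCallumLMS1991, §5 Lemma 5.1 (p. 303) and Cor. 5.6 (p. 310)]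
[cite: GrossLMS1991, Thm. 1.3 and §4 (4.1)] [cite: Darmon2004, Thm. 3.6–3.7 (PDF pp. 43–44)] -/
theorem boundAtP_of_structureIrred_of_divisibilityAtP_of_kolyvagin_of_newforms
    (hS : ∀ (W : WeierstrassCurve ℚ) [W.IsElliptic] [W.IsGloballyMinimal] [NeZero (W.conductorNorm ℤ)],
      ¬ W.HasCM →
      ∀ (K : Type) [Field K] [NumberField K], IsImaginaryQuadratic K →
      NumberField.discr K ≠ -3 → NumberField.discr K ≠ -4 →
      SatisfiesHeegnerHypothesis (W.conductorNorm ℤ) K →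
      ∀ (p : ℕ) [Fact p.Prime], p ≠ 2 → W.HasIrreducibleModPGaloisRep p →
      ∀ (Dt : ModularParametrizationData W (W.conductorNorm ℤ)) (β : ℤ) (ι : K →+* ℂ)
        (d₁ : KolyvaginHeegnerData Dt β ι 1) (P : (W.baseChange K).toAffine.Point),
        d₁.toGeomPoints d₁.derivedPoint = toGeomPoints (W.baseChange K) P →
        ¬ IsOfFinAddOrder P →
      ∀ (M₀ : ℕ),
        (∃ Q : (W.baseChange K).toAffine.Point, ((p ^ M₀ : ℕ) : ℤ) • Q = P) →
        (¬ ∃ Q : (W.baseChange K).toAffine.Point, ((p ^ (M₀ + 1) : ℕ) : ℤ) • Q = P) →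
      ∀ (t : ℕ),
        (∀ (s : ℕ), s ≤ t → ∀ (n : ℕ) (d : KolyvaginHeegnerData Dt β ι n), Squarefree n →
          (∀ ℓ ∈ n.primeFactors, Zhang2014.IsKolyvaginPrime (W.conductorNorm ℤ) W K p ℓ ∧
            s ≤ Zhang2014.kolyvaginIndex W p ℓ) →
          ∃ Q : (W.baseChange (ringClassField K ι n)).toAffine.Point,
            ((p ^ s : ℕ) : ℤ) • Q = d.derivedPoint) →
      padicValNat p (Nat.card (AddCommGroup.primaryComponent (W.baseChange K).sha p)) + 2 * t ≤ 2 * M₀)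
    (hDp : ∀ (W : WeierstrassCurve ℚ) [W.IsElliptic] [W.IsGloballyMinimal] [NeZero (W.conductorNorm ℤ)],
      ¬ W.HasCM →
      ∀ (K : Type) [Field K] [NumberField K], IsImaginaryQuadratic K →
      NumberField.discr K ≠ -3 → NumberField.discr K ≠ -4 →
      SatisfiesHeegnerHypothesis (W.conductorNorm ℤ) K →
      ∀ (p : ℕ) [Fact p.Prime], p ≠ 2 → W.analyticRank = 0 → Addv W p → 0 ≤ padicValRat p W.j →
      W.HasIrreducibleModPGaloisRep p → ¬ (∀ n : ℕ, W.HasSurjectiveModNGaloisRep (p ^ n : ℕ)) →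
      (∃ Dt : ModularParametrizationData W (W.conductorNorm ℤ),
        (∀ z ∈ Dt.L.lattice, ∃ w ∈ periodLattice Dt.f, z = (Dt.c : ℂ) * w) ∧ ¬ (p : ℤ) ∣ Dt.c) →
      ∀ (Dt : ModularParametrizationData W (W.conductorNorm ℤ)) (β : ℤ) (ι : K →+* ℂ)
        (d₁ : KolyvaginHeegnerData Dt β ι 1), ¬ IsOfFinAddOrder d₁.derivedPoint →
      ∀ (s : ℕ), s ≤ padicValNat p ((W.baseChange ℚ_[p]).localTamagawaNumber ℤ_[p]) →
      ∀ (n : ℕ) (d : KolyvaginHeegnerData Dt β ι n), Squarefree n →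
        (∀ ℓ ∈ n.primeFactors, Zhang2014.IsKolyvaginPrime (W.conductorNorm ℤ) W K p ℓ ∧
          s ≤ Zhang2014.kolyvaginIndex W p ℓ) →
        ∃ Q : (W.baseChange (ringClassField K ι n)).toAffine.Point,
          ((p ^ s : ℕ) : ℤ) • Q = d.derivedPoint)
    (hKo : ∀ (N : ℕ) [NeZero N] (W : WeierstrassCurve ℚ) (K : Type) [Field K] [NumberField K],
      kolyvagin N W K)
    (hnf : exists_isNewformOf)
    (N : ℕ) [NeZero N] (W : WeierstrassCurve ℚ) [W.IsElliptic] [W.IsGloballyMinimal]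
    (K : Type) [Field K] [NumberField K] (hK : IsImaginaryQuadratic K)
    (hD3 : NumberField.discr K ≠ -3) (hD4 : NumberField.discr K ≠ -4)
    (hHN : SatisfiesHeegnerHypothesis N K)
    (p : ℕ) [Fact p.Prime] (hp2 : p ≠ 2) (hr : W.analyticRank = 0) (hadd : Addv W p)
    (hj : 0 ≤ padicValRat p W.j) (hcm : ¬ W.HasCM) (hirr : W.HasIrreducibleModPGaloisRep p)
    (hns : ¬ (∀ n : ℕ, W.HasSurjectiveModNGaloisRep (p ^ n : ℕ)))
    (hopt : ∃ Dt : ModularParametrizationData W N,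
      (∀ z ∈ Dt.L.lattice, ∃ w ∈ periodLattice Dt.f, z = (Dt.c : ℂ) * w) ∧ ¬ (p : ℤ) ∣ Dt.c)
    {P : (W.baseChange K).toAffine.Point} (hP : IsHeegnerPoint N W K P) (hnt : ¬ IsOfFinAddOrder P) :
    padicValNat p (Nat.card (AddCommGroup.primaryComponent (W.baseChange K).sha p)) +
        2 * padicValNat p ((W.baseChange ℚ_[p]).localTamagawaNumber ℤ_[p]) ≤
      2 * padicValNat p (AddSubgroup.zmultiples P).index := by
  have hp : p.Prime := Fact.out
  -- Carayol from modularity: the level of the row's parametrisation datum is the conductor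
  obtain ⟨Dt, H, ι, hPc⟩ := id hP
  have hN : N = W.conductorNorm ℤ := IsNewformOf.level_eq_conductorNorm_of_exists_isNewformOf hnf Dt.isNewformOf
  subst hN
  -- rank one and finiteness of `Ш(E/K)` (Kolyvagin)
  obtain ⟨hrank, -⟩ := hKo _ W K hK hHN hP hnt
  -- a conductor-1 datum on the frame of `P` (Darmon 3.6, proved), with bottom point `P` (Shimura, proved)
  obtain ⟨d₁⟩ := exists_kolyvaginHeegnerData_one (phi_heegnerTau_mem_singularModuliField_holds _ W K) hK Dt
    H.β ι H.dvd_sq_sub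
  have hPd : d₁.toGeomPoints d₁.derivedPoint = toGeomPoints (W.baseChange K) P :=
    KolyvaginBottom.toGeomPoints_derivedPoint_one_eq (heegnerPointOfConductor_one_galoisConj_holds _ W K) hK
      hHN hPc d₁ rfl
  -- the exponent `p^{M₀} ∥ P` (Mordell–Weil)
  haveI : Module.Finite ℤ (W.baseChange K).toAffine.Point := (W.baseChange K).module_finite_point_holds
  obtain ⟨M₀, x₀, hx₀, hmax⟩ := exists_pow_smul_eq_and_forall_ne hnt (p := p) hp.two_le
  have hdiv : ∃ Q : (W.baseChange K).toAffine.Point, ((p ^ M₀ : ℕ) : ℤ) • Q = P :=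
    ⟨x₀, by rw [natCast_zsmul]; exact hx₀⟩
  have hndiv : ¬ ∃ Q : (W.baseChange K).toAffine.Point, ((p ^ (M₀ + 1) : ℕ) : ℤ) • Q = P := by
    rintro ⟨Q, hQ⟩
    exact hmax Q (by rw [← natCast_zsmul]; exact hQ)
  -- §1
  have hle := padicValNat_card_sha_primary_add_le_of_structureIrred_of_divisibilityAtP hS hDp W hcm K hK
    hD3 hD4 hHN p hp2 hr hadd hj hirr hns hopt Dt H.β ι d₁ P hPd hnt M₀ hdiv hndiv
  -- no `p`-torsion in `E(K)`: `E[p]` irreducible, `K` imaginary quadratic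
  have hbot := torsionBy_eq_bot_of_isImaginaryQuadratic_of_hasIrreducibleModPGaloisRep W K hK hp hirr
  have hiv : ∀ x : (W.baseChange K).toAffine.Point, p • x = 0 → x = 0 := fun x hx ↦ by
    have hmem : x ∈ AddSubgroup.torsionBy (W.baseChange K).toAffine.Point ((p : ℕ) : ℤ) := by
      rw [mem_torsionBy_iff, natCast_zsmul]
      exact hx
    rw [hbot] at hmem
    exact hmem
  -- `ord_p [E(K):ℤP] = M₀` (McCallum Lemma 5.1 over Mordell–Weil)
  haveI : Finite (AddCommGroup.torsion (W.baseChange K).toAffine.Point) :=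
    WeierstrassCurve.finite_torsion_point (W := W.baseChange K)
  obtain ⟨c, Q, hcQ, hcker⟩ := RankOne.exists_coord_of_mordellWeilRank_eq_one (W.baseChange K) hrank
  have hidx : padicValNat p (AddSubgroup.zmultiples P).index = M₀ :=
    Three.Koly.padicValNat_index_zmultiples_eq_of_divisibility c Q hcQ hcker hiv P hdiv hndiv
  rw [hidx]
  exact hle


/-! ### §3 The crux BY NAME: `WildJetchevBoundAtP` from S1, S2p, the held `PublishedInputsHeegner`, and the displayed `d_K = −4` supplement -/

/-- **The K9 crux `WildJetchevBoundAtP` (item 19941) from S1 + S2p + the route's held conjunction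
`PublishedInputsHeegner` (item 19914: Kolyvagin = conjunct 2, modularity = conjunct 4) + the displayed Gaussian-field
supplement `h4`.** The type is the route decl BY NAME. `h4` is the crux body at `NumberField.discr K = -4` verbatim —
the one instance family S1 (printed for `D_K ≠ −3, −4`) does not cover and the route's consumer (the J08 road, Heegner
field with `d_K < −4`) never uses; it is DISPLAYED, not asserted, so that the planner can either register it or drop
it by adding the binder `NumberField.discr K ≠ -4` to the crux (then §2 is the by-name reduction). CONDITIONAL on
`hS`, `hDp`, `h4`; closes NOTHING; BSD is not proved for any curve.
[cite: Jetchev2008, Conj. 1.3, Cor. 1.5 (p. 812)] [cite: MatarNekovar2019, Thm. 0.7 and §0.11 (pp. 456–457)]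
[cite: McCallumLMS1991, §5 Cor. 5.6 (p. 310)] [cite: GrossLMS1991, §3 (u_K) and Prop. 6.2 (1)] -/
theorem wildJetchevBoundAtP_of_structureIrred_of_divisibilityAtP_of_gaussianSupplement
    (hS : ∀ (W : WeierstrassCurve ℚ) [W.IsElliptic] [W.IsGloballyMinimal] [NeZero (W.conductorNorm ℤ)],
      ¬ W.HasCM →
      ∀ (K : Type) [Field K] [NumberField K], IsImaginaryQuadratic K →
      NumberField.discr K ≠ -3 → NumberField.discr K ≠ -4 →
      SatisfiesHeegnerHypothesis (W.conductorNorm ℤ) K →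
      ∀ (p : ℕ) [Fact p.Prime], p ≠ 2 → W.HasIrreducibleModPGaloisRep p →
      ∀ (Dt : ModularParametrizationData W (W.conductorNorm ℤ)) (β : ℤ) (ι : K →+* ℂ)
        (d₁ : KolyvaginHeegnerData Dt β ι 1) (P : (W.baseChange K).toAffine.Point),
        d₁.toGeomPoints d₁.derivedPoint = toGeomPoints (W.baseChange K) P →
        ¬ IsOfFinAddOrder P →
      ∀ (M₀ : ℕ),
        (∃ Q : (W.baseChange K).toAffine.Point, ((p ^ M₀ : ℕ) : ℤ) • Q = P) →
        (¬ ∃ Q : (W.baseChange K).toAffine.Point, ((p ^ (M₀ + 1) : ℕ) : ℤ) • Q = P) →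
      ∀ (t : ℕ),
        (∀ (s : ℕ), s ≤ t → ∀ (n : ℕ) (d : KolyvaginHeegnerData Dt β ι n), Squarefree n →
          (∀ ℓ ∈ n.primeFactors, Zhang2014.IsKolyvaginPrime (W.conductorNorm ℤ) W K p ℓ ∧
            s ≤ Zhang2014.kolyvaginIndex W p ℓ) →
          ∃ Q : (W.baseChange (ringClassField K ι n)).toAffine.Point,
            ((p ^ s : ℕ) : ℤ) • Q = d.derivedPoint) →
      padicValNat p (Nat.card (AddCommGroup.primaryComponent (W.baseChange K).sha p)) + 2 * t ≤ 2 * M₀)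
    (hDp : ∀ (W : WeierstrassCurve ℚ) [W.IsElliptic] [W.IsGloballyMinimal] [NeZero (W.conductorNorm ℤ)],
      ¬ W.HasCM →
      ∀ (K : Type) [Field K] [NumberField K], IsImaginaryQuadratic K →
      NumberField.discr K ≠ -3 → NumberField.discr K ≠ -4 →
      SatisfiesHeegnerHypothesis (W.conductorNorm ℤ) K →
      ∀ (p : ℕ) [Fact p.Prime], p ≠ 2 → W.analyticRank = 0 → Addv W p → 0 ≤ padicValRat p W.j →
      W.HasIrreducibleModPGaloisRep p → ¬ (∀ n : ℕ, W.HasSurjectiveModNGaloisRep (p ^ n : ℕ)) →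
      (∃ Dt : ModularParametrizationData W (W.conductorNorm ℤ),
        (∀ z ∈ Dt.L.lattice, ∃ w ∈ periodLattice Dt.f, z = (Dt.c : ℂ) * w) ∧ ¬ (p : ℤ) ∣ Dt.c) →
      ∀ (Dt : ModularParametrizationData W (W.conductorNorm ℤ)) (β : ℤ) (ι : K →+* ℂ)
        (d₁ : KolyvaginHeegnerData Dt β ι 1), ¬ IsOfFinAddOrder d₁.derivedPoint →
      ∀ (s : ℕ), s ≤ padicValNat p ((W.baseChange ℚ_[p]).localTamagawaNumber ℤ_[p]) →
      ∀ (n : ℕ) (d : KolyvaginHeegnerData Dt β ι n), Squarefree n →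
        (∀ ℓ ∈ n.primeFactors, Zhang2014.IsKolyvaginPrime (W.conductorNorm ℤ) W K p ℓ ∧
          s ≤ Zhang2014.kolyvaginIndex W p ℓ) →
        ∃ Q : (W.baseChange (ringClassField K ι n)).toAffine.Point,
          ((p ^ s : ℕ) : ℤ) • Q = d.derivedPoint)
    (hH : Theses.KatoDescentPotSupersingular.PublishedInputsHeegner)
    (h4 : ∀ (N : ℕ) [NeZero N] (W : WeierstrassCurve ℚ) [W.IsElliptic] [W.IsGloballyMinimal]
      (K : Type) [Field K] [NumberField K],
      IsImaginaryQuadratic K → NumberField.discr K = -4 → SatisfiesHeegnerHypothesis N K →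
      ∀ (p : ℕ) [Fact p.Prime], p ≠ 2 → W.analyticRank = 0 → Addv W p → 0 ≤ padicValRat p W.j →
      ¬ W.HasCM → W.HasIrreducibleModPGaloisRep p → ¬ (∀ n : ℕ, W.HasSurjectiveModNGaloisRep (p ^ n : ℕ)) →
      (∃ Dt : ModularParametrizationData W N,
        (∀ z ∈ Dt.L.lattice, ∃ w ∈ periodLattice Dt.f, z = (Dt.c : ℂ) * w) ∧ ¬ (p : ℤ) ∣ Dt.c) →
      ∀ {P : (W.baseChange K).toAffine.Point}, IsHeegnerPoint N W K P → ¬ IsOfFinAddOrder P → p ∣ N →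
      padicValNat p (Nat.card (AddCommGroup.primaryComponent (W.baseChange K).sha p)) +
          2 * padicValNat p ((W.baseChange ℚ_[p]).localTamagawaNumber ℤ_[p]) ≤
        2 * padicValNat p (AddSubgroup.zmultiples P).index) :
    Theses.KatoDescentPotSupersingular.WildJetchevBoundAtP := by
  unfold Theses.KatoDescentPotSupersingular.WildJetchevBoundAtP
  intro N _ W _ _ K _ _ hK hD3 hHN p _ hp2 hr hadd hj hcm hirr hns hopt P hP hnt hpN
  by_cases hD4 : NumberField.discr K = -4
  · exact h4 N W K hK hD4 hHN p hp2 hr hadd hj hcm hirr hns hopt hP hnt hpN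
  · exact boundAtP_of_structureIrred_of_divisibilityAtP_of_kolyvagin_of_newforms hS hDp hH.2.1 hH.2.2.2.1 N W
      K hK hD3 hD4 hHN p hp2 hr hadd hj hcm hirr hns hopt hP hnt

end Summit.BirchSwinnertonDyer.BirchSwinnertonDyer.Theorems.WildJetchevBoundAtPOfStubs

end
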